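import Summits.FinalStateConjecture.FinalStateConjecture.Theses.LeakageWritesInInk

/-!
# Route LeakageWritesInInk — the assembly `Assembly`

Assembly item `stmt-FinalStateConjecture-10229` of route `LeakageWritesInInk` for the Final State
Conjecture: the propositional chain

`LeakageTimeAnalyticity → TimeAnalyticLiouville → StationaryLimitReduction → FinalStateConjecture`.

The two cruxes `LeakageTimeAnalyticity` (A) and `TimeAnalyticLiouville` (S) quantify over the same
data `(a r₀ : ℝ)` and metric components `G`, under the byte-identical seven-clause hypothesis bundle
`h` of the shared target `EternalExteriorStationary` (X: a dark eternal harmonic-gauge vacuum exterior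
on `Kerr.region a r₀` is `t`-independent). A produces from `h` the uniform-strip time-analyticity
clause; S consumes `h` together with exactly that clause and returns `t`-independence of `G`, i.e.
the conclusion of X. So `A → S → X` by composition (this is the support item `InkChain`), and the
third crux `StationaryLimitReduction` is literally `X → FinalStateConjecture`. Hence the assembly is
pure logic — the same term the route's deciding theorem `closes` uses,
`hR (fun a r₀ G h ↦ hS a r₀ G h (hA a r₀ G h))`. No analysis happens here.
-/

-- every `Summit.FinalStateConjecture.FinalStateConjecture.…` name repeats the summit = sub-problem
-- segment (D-0017 layout, CONVENTIONS §2; lakefile sets it for the library build, a standalone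
-- elaboration of this file does not see that option); the duplicate is deliberate.
set_option linter.dupNamespace false

namespace Summit.FinalStateConjecture.FinalStateConjecture.Theorems

open Summit.FinalStateConjecture.FinalStateConjecture.Theses.LeakageWritesInInk in
/-- **Assembly** (item `stmt-FinalStateConjecture-10229`, route `LeakageWritesInInk`):
`LeakageTimeAnalyticity → TimeAnalyticLiouville → StationaryLimitReduction → FinalStateConjecture`.
Given the hypothesis bundle `h` of the eternal-exterior target for `(a, r₀, G)`, the first crux `hA`
yields the uniform-strip time-analyticity of `G`, the second crux `hS` turns `h` plus that strip into
`G (x + s • e₀) = G x` on the whole region — so `EternalExteriorStationary` holds — and the reduction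
`hR : EternalExteriorStationary → FinalStateConjecture` finishes. -/
theorem leakageWritesInInk_assembly_proof :
    Summit.FinalStateConjecture.FinalStateConjecture.Theses.LeakageWritesInInk.Assembly := by
  unfold Assembly
  intro hA hS hR
  exact hR (fun a r₀ G h ↦ hS a r₀ G h (hA a r₀ G h))

end Summit.FinalStateConjecture.FinalStateConjecture.Theorems
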